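import Mathlib.Analysis.SpecialFunctions.Complex.LogBounds
import Mathlib.Analysis.SpecialFunctions.Pow.Real
import Mathlib.LinearAlgebra.Vandermonde
import Mathlib.RingTheory.RootsOfUnity.Complex
import Mathlib.Algebra.Field.GeomSum
import Mathlib.Tactic
import Literature.NumberTheory.DiophantineApproximation.LeVequeInequality
import Literature.Analysis.Matrix.HadamardInequality
import HarnessLib

/-!
# Vandermondians on the unit circle: Fekete's bound and Bilu's non-equidistribution lemma

For `z = (z_1, …, z_d) ∈ 𝕋^d` on the unit circle write
`|V(z)| = ∏_{1 ≤ i < j ≤ d} |z_i - z_j|` for the absolute value of the Vandermonde determinant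
`det (z_i^{k-1})`. This file proves the two facts about `|V|` on the unit polycircle that drive
the "holomorphic dampener"/cross-integration step of Calegari–Dimitrov–Tang
[CalegariDimitrovTang2024, §6.5.1 "Vandermondians", Lemma 63 and Lemma 64 (p. 52)], which are
quoted there from the authors' earlier paper [CalegariDimitrovTang2025, §2.5.1, Lemma 10 and
Lemma 13 (pp. 12–13)]:

* **Fekete** (CDT 2024 Lemma 63 = CDT 2021 Lemma 10): `sup_{𝕋^d} |V| = d^{d/2}`, attained at
  the vertices of a regular `d`-gon — `vandermondeAbs_le_rpow` (the bound, by Hadamard's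
  inequality applied to the Vandermonde matrix, exactly as indicated in [CalegariDimitrovTang2025,
  p. 12]), `vandermondeAbs_regularPolygon` (equality for the regular polygon, via `F Fᴴ = d·1` for
  the Fourier matrix `F`) and `isGreatest_vandermondeAbs` (the supremum statement).
  TODO(only-if): the converse half of the equality case ("equality only for regular `d`-gons") is
  not formalized here.
* **Bilu's non-equidistribution lemma** (CDT 2024 Lemma 64 = CDT 2021 Lemma 13, "essentially
  Bilu's equidistribution theorem [Bilu1997] in a mild disguise"): there are functions
  `c(ε) > 0`, `d₀(ε)` such that for `d ≥ d₀(ε)` every `d`-tuple of discrepancy `D(z) ≥ ε` has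
  `|V(z)| < e^{-c(ε) d²}` — `bilu_nonEquidistribution` (as printed) and the explicit form
  `vandermondeAbs_lt_exp_of_le_boxDiscrepancy` with `c(ε) = π²ε³/192`.

**Deviation from print (method, not statement).** The printed proof of Lemma 13 in
[CalegariDimitrovTang2025, p. 13] is soft (Banach–Alaoglu, equilibrium measure of the circle,
positivity of the logarithmic energy), none of which is in Mathlib. We give instead the effective
Fourier-side argument (in the spirit of Bombieri–Gubler's treatment of Bilu's theorem cited
loc. cit.): for `0 ≤ r < 1` and `|w| = 1`, `|1 - w| ≤ (2/(1+r)) |1 - r w|` and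
`Σ_{i ≠ j} log|1 - r z_j \bar z_i| = -Σ_{n ≥ 1} (rⁿ/n)(|S_n|² - d)` with the power sums
`S_n = Σ_j z_jⁿ` (Taylor series of `-log(1-u)`, `Complex.hasSum_taylorSeries_neg_log`), so that
`2 log|V| ≤ d² log(2/(1+r)) + d log(1/(1-r)) - Σ_{n ≤ H} (rⁿ/n)|S_n|²`, while a discrepancy
`D ≥ ε` forces `Σ_{n ≤ H} |S_n|²/n² ≥ d²(π²ε³/6 - 1/H)` by **LeVeque's inequality**
`D³ ≤ (6/π²) Σ_n |S_n/d|²/n²` (the tree's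
`Literature.NumberTheory.DiophantineApproximation.Discrepancy.leVeque`); choosing `H ≍ ε⁻³` and
`1 - r ≍ ε³/H` gives `|V| < exp(-(π²ε³/192) d²)` for `d ≥ d₀(ε)`.

Points of `𝕋^d` are parametrized as `z_j = e(t_j) = exp(2πi t_j)`, `t ∈ [0,1)^d`, and `D` is the
box discrepancy `boxDiscrepancy t` of [CalegariDimitrovTang2024, Def. 44] from the LeVeque file.

## References
* [CalegariDimitrovTang2024] F. Calegari, V. Dimitrov, Y. Tang, *The linear independence of 1,
  ζ(2) and L(2, χ₋₃)*, arXiv:2408.15403 (2024), §6.5.1, Lemmas 63–64.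
* [CalegariDimitrovTang2025] F. Calegari, V. Dimitrov, Y. Tang, *The unbounded denominators
  conjecture*, J. Amer. Math. Soc. 38 (2025) 627–702 (arXiv:2109.09040, 2021), §2.5.1,
  Lemmas 10 and 13 (numbering of the arXiv version).
* [Bilu1997] Yu. Bilu, *Limit distribution of small points on algebraic tori*, Duke Math. J. 89
  (1997) 465–476.
-/

namespace Literature.NumberTheory.DiophantineApproximation

namespace Discrepancy

open Finset Complex
open scoped Real ComplexConjugate

noncomputable section

/-! ### The Vandermondian `|V(z)| = ∏_{i<j} |z_j - z_i|` -/

/-- `|V(z)| = ∏_{i<j} |z_j - z_i|`, the absolute value of the Vandermonde determinant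
`det (z_i^k)_{i,k}`. [cite: CalegariDimitrovTang2024, §6.5.1 eq. before Lemma 63] -/
def vandermondeAbs {d : ℕ} (z : Fin d → ℂ) : ℝ := ∏ i, ∏ j ∈ Ioi i, ‖z j - z i‖

/-- `|V(z)| ≥ 0`. [folklore] -/
theorem vandermondeAbs_nonneg {d : ℕ} (z : Fin d → ℂ) : 0 ≤ vandermondeAbs z :=
  prod_nonneg fun _ _ => prod_nonneg fun _ _ => norm_nonneg _

/-- `|V(z)| = |det (vandermonde z)|`. [folklore] -/
theorem vandermondeAbs_eq_norm_det {d : ℕ} (z : Fin d → ℂ) :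
    vandermondeAbs z = ‖(Matrix.vandermonde z).det‖ := by
  rw [Matrix.det_vandermonde, norm_prod]
  simp_rw [norm_prod]
  rfl

/-! ### Fekete: `|V| ≤ d^{d/2}` on the closed unit polydisc, with equality at the regular `d`-gon -/

/-- Hadamard's inequality for the Vandermonde matrix of points of modulus `≤ 1`:
`|V(z)|² ≤ dᵈ`. [cite: CalegariDimitrovTang2025, §2.5.1 Lemma 10 (proof indication)] -/
theorem vandermondeAbs_sq_le {d : ℕ} (z : Fin d → ℂ) (hz : ∀ i, ‖z i‖ ≤ 1) :
    vandermondeAbs z ^ 2 ≤ (d : ℝ) ^ d := by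
  rw [vandermondeAbs_eq_norm_det]
  have h := Literature.Analysis.Matrix.norm_det_sq_le_of_entry_le (Matrix.vandermonde z)
    (fun _ => 1) (fun i j => by
      rw [Matrix.vandermonde_apply, norm_pow]
      exact pow_le_one₀ (norm_nonneg _) (hz i))
  simpa using h

/-- **Fekete's bound** `|V(z)| ≤ d^{d/2}` for `z` in the closed unit polydisc (in particular on
the unit polycircle `𝕋ᵈ`). [cite: CalegariDimitrovTang2024, Lemma 63;
CalegariDimitrovTang2025, Lemma 10] -/
theorem vandermondeAbs_le_rpow {d : ℕ} (z : Fin d → ℂ) (hz : ∀ i, ‖z i‖ ≤ 1) :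
    vandermondeAbs z ≤ (d : ℝ) ^ ((d : ℝ) / 2) := by
  have h := Real.abs_le_sqrt (vandermondeAbs_sq_le z hz)
  rw [abs_of_nonneg (vandermondeAbs_nonneg z)] at h
  convert h using 1
  rw [Real.sqrt_eq_rpow, ← Real.rpow_natCast, ← Real.rpow_mul (Nat.cast_nonneg d)]
  ring_nf

/-- The vertices `ωʲ`, `ω = e^{2πi/d}`, of the regular `d`-gon inscribed in the unit circle.
[folklore] -/
def regularPolygon (d : ℕ) : Fin d → ℂ := fun j => Complex.exp (2 * π * I / d) ^ (j : ℕ)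

/-- The vertices of the regular polygon lie on the unit circle. [folklore] -/
theorem norm_regularPolygon {d : ℕ} (j : Fin d) : ‖regularPolygon d j‖ = 1 := by
  have hd : d ≠ 0 := by rintro rfl; exact j.elim0
  simp only [regularPolygon, norm_pow, (Complex.isPrimitiveRoot_exp d hd).norm'_eq_one hd, one_pow]

/-- For the Fourier matrix `F = (ω^{jk})`, `F Fᴴ = d · 1`. [folklore] -/
theorem vandermonde_regularPolygon_mul_conjTranspose (d : ℕ) :
    Matrix.vandermonde (regularPolygon d) * (Matrix.vandermonde (regularPolygon d)).conjTranspose =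
      (d : ℂ) • (1 : Matrix (Fin d) (Fin d) ℂ) := by
  rcases Nat.eq_zero_or_pos d with rfl | hd
  · ext i; exact i.elim0
  unfold regularPolygon
  set ω : ℂ := Complex.exp (2 * π * I / d) with hω
  have hprim : IsPrimitiveRoot ω d := Complex.isPrimitiveRoot_exp d hd.ne'
  have hω1 : ‖ω‖ = 1 := hprim.norm'_eq_one hd.ne'
  have hω0 : ω ≠ 0 := fun h => by simp [h] at hω1
  ext j l
  simp only [Matrix.mul_apply, Matrix.conjTranspose_apply, Matrix.vandermonde_apply,
    Matrix.smul_apply, Matrix.one_apply, smul_eq_mul, mul_ite, mul_one, mul_zero]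
  -- the `(j,l)` entry is the geometric sum of `ρ = ω^j (ω^l)⁻¹`
  set ρ : ℂ := ω ^ (j : ℕ) * (ω ^ (l : ℕ))⁻¹ with hρ
  have hterm : ∀ k : Fin d, (ω ^ (j : ℕ)) ^ (k : ℕ) * star ((ω ^ (l : ℕ)) ^ (k : ℕ)) = ρ ^ (k : ℕ) := by
    intro k
    have hunit : ‖(ω ^ (l : ℕ)) ^ (k : ℕ)‖ = 1 := by simp [norm_pow, hω1]
    rw [Complex.star_def, ← Complex.inv_eq_conj hunit, hρ, mul_pow, inv_pow]
  simp_rw [hterm]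
  rw [Fin.sum_univ_eq_sum_range (fun k => ρ ^ k) d]
  by_cases hjl : j = l
  · subst hjl
    have hρ1 : ρ = 1 := by rw [hρ, mul_inv_cancel₀ (pow_ne_zero _ hω0)]
    simp [hρ1]
  · rw [if_neg hjl]
    have hρ1 : ρ ≠ 1 := by
      intro h
      apply hjl
      have h' : ω ^ (j : ℕ) = ω ^ (l : ℕ) := by
        rw [hρ, mul_inv_eq_one₀ (pow_ne_zero _ hω0)] at h
        exact h
      exact Fin.ext (hprim.pow_inj j.isLt l.isLt h')
    have hρd : ρ ^ d = 1 := by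
      rw [hρ, mul_pow, inv_pow, ← pow_mul, ← pow_mul, mul_comm (j : ℕ), mul_comm (l : ℕ), pow_mul,
        pow_mul, hprim.pow_eq_one, one_pow, one_pow, inv_one, mul_one]
    rw [geom_sum_eq hρ1, hρd, sub_self, zero_div]

/-- Equality in Fekete's bound at the regular `d`-gon: `|V(1, ω, …, ω^{d-1})|² = dᵈ`.
[cite: CalegariDimitrovTang2024, Lemma 63; CalegariDimitrovTang2025, Lemma 10] -/
theorem vandermondeAbs_regularPolygon_sq (d : ℕ) : vandermondeAbs (regularPolygon d) ^ 2 = (d : ℝ) ^ d := by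
  have h := Literature.Analysis.Matrix.det_mul_conjTranspose_self (Matrix.vandermonde (regularPolygon d))
  rw [vandermonde_regularPolygon_mul_conjTranspose, Matrix.det_smul, Matrix.det_one, mul_one,
    Fintype.card_fin] at h
  rw [vandermondeAbs_eq_norm_det]
  exact_mod_cast h.symm

/-- `|V(1, ω, …, ω^{d-1})| = d^{d/2}`. [cite: CalegariDimitrovTang2024, Lemma 63] -/
theorem vandermondeAbs_regularPolygon (d : ℕ) :
    vandermondeAbs (regularPolygon d) = (d : ℝ) ^ ((d : ℝ) / 2) := by
  have h2 : (vandermondeAbs (regularPolygon d)) ^ (2 : ℝ) = (d : ℝ) ^ (d : ℝ) := by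
    rw [Real.rpow_two, Real.rpow_natCast, vandermondeAbs_regularPolygon_sq]
  have h0 := vandermondeAbs_nonneg (regularPolygon d)
  calc vandermondeAbs (regularPolygon d)
      = ((vandermondeAbs (regularPolygon d)) ^ (2 : ℝ)) ^ ((1 : ℝ) / 2) := by
        rw [← Real.rpow_mul h0]; norm_num
    _ = (d : ℝ) ^ ((d : ℝ) / 2) := by
        rw [h2, ← Real.rpow_mul (Nat.cast_nonneg d)]; ring_nf

/-- **Fekete's lemma** (CDT form): the supremum of `|V(z)|` over the unit polycircle `𝕋ᵈ` equals
`d^{d/2}` and is attained (at the regular `d`-gon). [cite: CalegariDimitrovTang2024, Lemma 63;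
CalegariDimitrovTang2025, Lemma 10] -/
theorem isGreatest_vandermondeAbs (d : ℕ) :
    IsGreatest {v : ℝ | ∃ z : Fin d → ℂ, (∀ i, ‖z i‖ = 1) ∧ vandermondeAbs z = v}
      ((d : ℝ) ^ ((d : ℝ) / 2)) :=
  ⟨⟨regularPolygon d, norm_regularPolygon, vandermondeAbs_regularPolygon d⟩,
    by rintro v ⟨z, hz, rfl⟩; exact vandermondeAbs_le_rpow z fun i => (hz i).le⟩

/-! ### Bilu's non-equidistribution lemma -/

/-- The point `e(θ) = exp(2πiθ)` of the unit circle. [folklore] -/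
def unitPt (θ : ℝ) : ℂ := Complex.exp (((2 * π * θ : ℝ) : ℂ) * I)

/-- `|e(θ)| = 1`. [folklore] -/
theorem norm_unitPt (θ : ℝ) : ‖unitPt θ‖ = 1 := Complex.norm_exp_ofReal_mul_I _

/-- `e(θ)ⁿ = e(nθ)`. [folklore] -/
theorem unitPt_pow (θ : ℝ) (n : ℕ) : unitPt θ ^ n = unitPt (n * θ) := by
  rw [unitPt, unitPt, ← Complex.exp_nat_mul]
  congr 1; push_cast; ring

/-- `Re e(θ)ⁿ = cos(2πnθ)`. [folklore] -/
theorem unitPt_pow_re (θ : ℝ) (n : ℕ) : (unitPt θ ^ n).re = Real.cos (2 * π * n * θ) := by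
  rw [unitPt_pow, unitPt, Complex.exp_ofReal_mul_I_re]; ring_nf

/-- `e(b - a) = e(b) e(a)⁻¹`. [folklore] -/
theorem unitPt_sub (a b : ℝ) : unitPt (b - a) = unitPt b * (unitPt a)⁻¹ := by
  rw [unitPt, unitPt, unitPt, ← Complex.exp_neg, ← Complex.exp_add]
  congr 1; push_cast; ring

/-- `|e(a) - e(b)| = |1 - e(b - a)|`. [folklore] -/
theorem norm_unitPt_sub_unitPt (a b : ℝ) : ‖unitPt b - unitPt a‖ = ‖1 - unitPt (b - a)‖ := by
  have ha : unitPt a ≠ 0 := by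
    intro h; have := norm_unitPt a; rw [h, norm_zero] at this; exact zero_ne_one this
  have : unitPt b - unitPt a = -(unitPt a * (1 - unitPt (b - a))) := by
    rw [unitPt_sub]; field_simp; ring
  rw [this, norm_neg, norm_mul, norm_unitPt, one_mul]

/-- The elementary comparison `|1 - w| ≤ (2/(1+r)) |1 - r w|` for `|w| = 1`, `r ≥ 0`
(the worst case is `w = -1`). [folklore] -/
theorem norm_one_sub_le_of_norm_eq_one (w : ℂ) (hw : ‖w‖ = 1) {r : ℝ} (hr0 : 0 ≤ r) :
    ‖1 - w‖ ≤ 2 / (1 + r) * ‖1 - r * w‖ := by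
  have hxy : w.re * w.re + w.im * w.im = 1 := by
    rw [← Complex.normSq_apply, Complex.normSq_eq_norm_sq, hw, one_pow]
  have h1 : ‖1 - w‖ ^ 2 = 2 - 2 * w.re := by
    rw [← Complex.normSq_eq_norm_sq, Complex.normSq_apply]
    simp only [Complex.sub_re, Complex.one_re, Complex.sub_im, Complex.one_im, zero_sub]
    nlinarith [hxy]
  have h2 : ‖1 - r * w‖ ^ 2 = 1 - 2 * r * w.re + r ^ 2 := by
    rw [← Complex.normSq_eq_norm_sq, Complex.normSq_apply]
    simp only [Complex.sub_re, Complex.one_re, Complex.sub_im, Complex.one_im, zero_sub,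
      Complex.re_ofReal_mul, Complex.im_ofReal_mul]
    nlinarith [hxy]
  have hre : -1 ≤ w.re := by nlinarith [sq_nonneg w.im, sq_nonneg (w.re + 1)]
  have hr' : (0 : ℝ) < 1 + r := by linarith
  rw [div_mul_eq_mul_div, le_div_iff₀ hr']
  have ha : 0 ≤ ‖1 - w‖ * (1 + r) := by positivity
  have hb : 0 ≤ 2 * ‖1 - r * w‖ := by positivity
  refine (pow_le_pow_iff_left₀ ha hb two_ne_zero).mp ?_
  rw [mul_pow, mul_pow, h1, h2]
  nlinarith [mul_nonneg (mul_nonneg (sq_nonneg (1 - r)) (by linarith : (0 : ℝ) ≤ 1 + w.re)) zero_le_two]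

/-- The real part of the logarithmic series: for `0 ≤ r < 1`,
`Σ_{n ≥ 1} rⁿ cos(2πnθ)/n = -log|1 - r e(θ)|`. [folklore] -/
theorem hasSum_cos_div_log (θ : ℝ) {r : ℝ} (hr0 : 0 ≤ r) (hr1 : r < 1) :
    HasSum (fun n : ℕ => r ^ n * Real.cos (2 * π * n * θ) / n) (-Real.log ‖1 - r * unitPt θ‖) := by
  set u : ℂ := (r : ℂ) * unitPt θ with hu
  have hnorm : ‖u‖ < 1 := by
    rw [hu, norm_mul, norm_unitPt, mul_one, Complex.norm_real, Real.norm_eq_abs, abs_of_nonneg hr0]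
    exact hr1
  have h := ((Complex.hasSum_iff _ _).mp (Complex.hasSum_taylorSeries_neg_log hnorm)).1
  convert h using 1
  · funext n
    rw [Complex.div_natCast_re, hu, mul_pow, ← Complex.ofReal_pow, Complex.re_ofReal_mul,
      unitPt_pow_re]
  · rw [Complex.neg_re, Complex.log_re]

variable {N : ℕ}

/-- `|S_n|² = Σ_{i,j} cos(2πn(t_j - t_i))` for the Weyl sum `S_n = Σ_j e(n t_j)`. [folklore] -/
theorem norm_weylSum_sq_eq (t : Fin N → ℝ) (n : ℕ) :
    ‖weylSum t n‖ ^ 2 = ∑ i, ∑ j, Real.cos (2 * π * n * (t j - t i)) := by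
  have hS : weylSum t n = ∑ j, unitPt (t j) ^ n := by
    unfold weylSum
    refine Finset.sum_congr rfl fun j _ => ?_
    rw [unitPt_pow, unitPt]
    congr 1; push_cast; ring
  have hC : ((‖weylSum t n‖ ^ 2 : ℝ) : ℂ) = ∑ i, ∑ j, conj (unitPt (t i) ^ n) * unitPt (t j) ^ n := by
    rw [← Complex.normSq_eq_norm_sq, Complex.normSq_eq_conj_mul_self, hS, map_sum,
      Finset.sum_mul_sum]
  have hterm : ∀ i j, conj (unitPt (t i) ^ n) * unitPt (t j) ^ n = unitPt (t j - t i) ^ n := by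
    intro i j
    rw [← Complex.inv_eq_conj (by rw [norm_pow, norm_unitPt, one_pow]),
      unitPt_sub, mul_pow, inv_pow, mul_comm]
  simp_rw [hterm] at hC
  apply_fun Complex.re at hC
  rw [Complex.ofReal_re] at hC
  rw [hC, Complex.re_sum]
  refine Finset.sum_congr rfl fun i _ => ?_
  rw [Complex.re_sum]
  exact Finset.sum_congr rfl fun j _ => unitPt_pow_re _ _

/-- Off-diagonal part: `Σ_i Σ_{j ≠ i} cos(2πn(t_j - t_i)) = |S_n|² - N`. [folklore] -/
theorem sum_erase_cos_eq (t : Fin N → ℝ) (n : ℕ) :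
    ∑ i, ∑ j ∈ univ.erase i, Real.cos (2 * π * n * (t j - t i)) = ‖weylSum t n‖ ^ 2 - N := by
  rw [norm_weylSum_sq_eq]
  have : ∀ i : Fin N, ∑ j ∈ univ.erase i, Real.cos (2 * π * n * (t j - t i)) =
      ∑ j, Real.cos (2 * π * n * (t j - t i)) - 1 := by
    intro i
    rw [Finset.sum_erase_eq_sub (Finset.mem_univ i), sub_self, mul_zero, Real.cos_zero]
  simp_rw [this]
  rw [Finset.sum_sub_distrib, Finset.sum_const, Finset.card_univ, Fintype.card_fin, nsmul_eq_mul,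
    mul_one]

/-- `(∏_{i<j} f i j)² = ∏_{i ≠ j} f i j` for a symmetric `f`. [folklore] -/
theorem prod_Ioi_sq_eq_prod_erase (f : Fin N → Fin N → ℝ) (hf : ∀ i j, f i j = f j i) :
    (∏ i, ∏ j ∈ Ioi i, f i j) ^ 2 = ∏ i, ∏ j ∈ univ.erase i, f i j := by
  have hsplit : ∀ i : Fin N, ∏ j ∈ univ.erase i, f i j = (∏ j ∈ Ioi i, f i j) * ∏ j ∈ Iio i, f i j := by
    intro i
    have hunion : univ.erase i = Ioi i ∪ Iio i := by
      ext j
      simp only [mem_erase, mem_univ, and_true, mem_union, mem_Ioi, mem_Iio]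
      constructor
      · intro h; exact (lt_or_gt_of_ne h).symm
      · rintro (h | h) <;> [exact h.ne'; exact h.ne]
    rw [hunion, Finset.prod_union]
    exact Finset.disjoint_left.mpr fun j hj hj' => lt_asymm (mem_Ioi.mp hj) (mem_Iio.mp hj')
  simp_rw [hsplit]
  rw [Finset.prod_mul_distrib, sq]
  congr 1
  -- exchange the order in `∏_i ∏_{j<i} f i j` and use symmetry
  rw [Finset.prod_comm' (s := univ) (t := fun i => Iio i) (t' := univ) (s' := fun j => Ioi j)
    (h := fun i j => by simp only [mem_univ, true_and, and_true, mem_Iio, mem_Ioi])]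
  exact Finset.prod_congr rfl fun j _ => Finset.prod_congr rfl fun i _ => hf j i

/-- `|V(e(t))|² = ∏_{i ≠ j} |1 - e(t_j - t_i)|`. [folklore] -/
theorem vandermondeAbs_unitPt_sq (t : Fin N → ℝ) :
    vandermondeAbs (fun n => unitPt (t n)) ^ 2 = ∏ i, ∏ j ∈ univ.erase i, ‖1 - unitPt (t j - t i)‖ := by
  unfold vandermondeAbs
  simp_rw [norm_unitPt_sub_unitPt]
  refine prod_Ioi_sq_eq_prod_erase (fun i j => ‖1 - unitPt (t j - t i)‖) fun i j => ?_
  rw [← norm_unitPt_sub_unitPt, ← norm_unitPt_sub_unitPt, norm_sub_rev]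

/-- Tail of `Σ 1/n²`: `Σ_{n<M} 1/(n+H+1)² ≤ 1/H`. [folklore] -/
theorem sum_inv_sq_shift_le {H : ℕ} (hH : 1 ≤ H) (M : ℕ) :
    ∑ n ∈ range M, (1 : ℝ) / ((n : ℝ) + H + 1) ^ 2 ≤ 1 / (H : ℝ) := by
  have hHr : (1 : ℝ) ≤ H := by exact_mod_cast hH
  suffices h : ∑ n ∈ range M, (1 : ℝ) / ((n : ℝ) + H + 1) ^ 2 ≤ 1 / (H : ℝ) - 1 / ((M : ℝ) + H) by
    have : (0 : ℝ) ≤ 1 / ((M : ℝ) + H) := by positivity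
    linarith
  induction M with
  | zero => simp
  | succ M ih =>
    rw [Finset.sum_range_succ]
    have hkey : (1 : ℝ) / ((M : ℝ) + H + 1) ^ 2 ≤ 1 / ((M : ℝ) + H) - 1 / ((M : ℝ) + H + 1) := by
      rw [div_sub_div _ _ (by positivity) (by positivity), div_le_div_iff₀ (by positivity) (by positivity)]
      nlinarith
    have hcast : (1 : ℝ) / ((M : ℝ) + 1 + H) = 1 / ((M : ℝ) + H + 1) := by ring_nf
    push_cast
    rw [hcast]
    linarith

/-- **The key estimate.** For `t ∈ [0,1)^N` (`N ≥ 1`), `0 ≤ r < 1` and `H ≥ 1`: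
`|V(e(t))|² ≤ exp( N² log(2/(1+r)) + N log(1/(1-r)) - r^H N² (π² D(t)³/6 - 1/H) )`.
[cite: CalegariDimitrovTang2024, Lemma 64 (proof route via LeVeque's inequality, see the module
docstring)] -/
theorem vandermondeAbs_sq_le_exp (t : Fin N → ℝ) (hN : 0 < N) (ht0 : ∀ n, 0 ≤ t n) (ht1 : ∀ n, t n < 1)
    {r : ℝ} (hr0 : 0 ≤ r) (hr1 : r < 1) {H : ℕ} (hH : 1 ≤ H) :
    vandermondeAbs (fun n => unitPt (t n)) ^ 2 ≤
      Real.exp ((N : ℝ) ^ 2 * Real.log (2 / (1 + r)) + N * Real.log (1 / (1 - r))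
        - r ^ H * (N : ℝ) ^ 2 * (π ^ 2 * boxDiscrepancy t ^ 3 / 6 - 1 / H)) := by
  have hNr : (0 : ℝ) < N := by exact_mod_cast hN
  -- notation
  set w : Fin N → Fin N → ℂ := fun i j => unitPt (t j - t i) with hw
  have hw1 : ∀ i j, ‖w i j‖ = 1 := fun i j => norm_unitPt _
  have hpos : ∀ i j, 0 < ‖1 - r * w i j‖ := by
    intro i j
    have : 1 - r ≤ ‖1 - (r : ℂ) * w i j‖ := by
      calc 1 - r = ‖(1 : ℂ)‖ - ‖(r : ℂ) * w i j‖ := by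
            rw [norm_one, norm_mul, hw1, mul_one, Complex.norm_real, Real.norm_eq_abs, abs_of_nonneg hr0]
        _ ≤ ‖1 - (r : ℂ) * w i j‖ := norm_sub_norm_le _ _
    linarith
  -- Step 1: `V² ≤ (2/(1+r))^{N(N-1)} ∏_{i≠j} |1 - r w_ij|`
  set L : ℝ := ∑ i, ∑ j ∈ univ.erase i, Real.log ‖1 - r * w i j‖ with hL
  have hexp : Real.exp L = ∏ i, ∏ j ∈ univ.erase i, ‖1 - r * w i j‖ := by
    rw [hL, Real.exp_sum]
    refine Finset.prod_congr rfl fun i _ => ?_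
    rw [Real.exp_sum]
    exact Finset.prod_congr rfl fun j _ => Real.exp_log (hpos i j)
  have hstep1 : vandermondeAbs (fun n => unitPt (t n)) ^ 2 ≤
      (2 / (1 + r)) ^ (N * (N - 1)) * Real.exp L := by
    rw [vandermondeAbs_unitPt_sq, hexp]
    have hcard : ∀ i : Fin N, (univ.erase i).card = N - 1 := fun i => by
      rw [Finset.card_erase_of_mem (mem_univ i), card_univ, Fintype.card_fin]
    have : (2 / (1 + r)) ^ (N * (N - 1)) = ∏ i : Fin N, ∏ _j ∈ univ.erase i, (2 / (1 + r) : ℝ) := by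
      simp_rw [Finset.prod_const, hcard]
      rw [Finset.prod_const, card_univ, Fintype.card_fin, ← pow_mul, mul_comm]
    rw [this, ← Finset.prod_mul_distrib]
    refine Finset.prod_le_prod (fun i _ => prod_nonneg fun j _ => norm_nonneg _) fun i _ => ?_
    rw [← Finset.prod_mul_distrib]
    refine Finset.prod_le_prod (fun j _ => norm_nonneg _) fun j _ => ?_
    exact norm_one_sub_le_of_norm_eq_one _ (hw1 i j) hr0
  -- Step 2: `L = -Σ_n (rⁿ/n)(|S_n|² - N)`, hence `L ≤ N log(1/(1-r)) - Σ_{n≤H} rⁿ|S_n|²/n`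
  set a : ℕ → ℝ := fun n => r ^ n * ‖weylSum t n‖ ^ 2 / n with ha
  set b : ℕ → ℝ := fun n => r ^ n * N / n with hb
  have hG : HasSum (fun n : ℕ => a n - b n) (-L) := by
    have h := hasSum_sum (s := (univ : Finset (Fin N))) (f := fun i (n : ℕ) =>
        ∑ j ∈ univ.erase i, r ^ n * Real.cos (2 * π * n * (t j - t i)) / n)
      (a := fun i => ∑ j ∈ univ.erase i, -Real.log ‖1 - r * w i j‖)
      (fun i _ => hasSum_sum fun j _ => hasSum_cos_div_log (t j - t i) hr0 hr1)
    have hLsum : ∑ i, ∑ j ∈ univ.erase i, -Real.log ‖1 - r * w i j‖ = -L := by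
      rw [hL, ← Finset.sum_neg_distrib]
      exact Finset.sum_congr rfl fun i _ => by rw [Finset.sum_neg_distrib]
    rw [hLsum] at h
    convert h using 1
    funext n
    rw [ha, hb]
    simp only
    have : ∑ i : Fin N, ∑ j ∈ univ.erase i, r ^ n * Real.cos (2 * π * n * (t j - t i)) / n =
        r ^ n * (∑ i : Fin N, ∑ j ∈ univ.erase i, Real.cos (2 * π * n * (t j - t i))) / n := by
      rw [Finset.mul_sum, Finset.sum_div]
      refine Finset.sum_congr rfl fun i _ => ?_
      rw [Finset.mul_sum, Finset.sum_div]
    rw [this, sum_erase_cos_eq]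
    ring
  have hb' : HasSum b (N * -Real.log (1 - r)) := by
    have h0 := hasSum_cos_div_log 0 hr0 hr1
    have h1 : ‖1 - (r : ℂ) * unitPt 0‖ = 1 - r := by
      rw [unitPt, mul_zero, Complex.ofReal_zero, zero_mul, Complex.exp_zero, mul_one]
      rw [show (1 : ℂ) - r = ((1 - r : ℝ) : ℂ) by push_cast; ring, Complex.norm_real, Real.norm_eq_abs,
        abs_of_pos (by linarith)]
    rw [h1] at h0
    simp only [mul_zero, Real.cos_zero, mul_one] at h0
    have hfun : b = fun n : ℕ => (N : ℝ) * (r ^ n / (n : ℝ)) := by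
      funext n; simp only [hb]; ring
    rw [hfun]
    exact h0.mul_left (N : ℝ)
  have ha' : HasSum a (-L + N * -Real.log (1 - r)) := by
    have := hG.add hb'
    simpa using this
  have ha0 : ∀ n, 0 ≤ a n := fun n => by rw [ha]; positivity
  have hAH : ∑ n ∈ range (H + 1), a n ≤ -L + N * -Real.log (1 - r) :=
    sum_le_hasSum _ (fun n _ => ha0 n) ha'
  -- Step 3: LeVeque: `Σ_{n ≤ H} rⁿ |S_n|²/n ≥ r^H N² (π² D³/6 - 1/H)`
  set s : ℕ → ℝ := fun n => ‖weylSum t (n + 1)‖ ^ 2 / (((n : ℝ) + 1) ^ 2 * N ^ 2) with hs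
  have hs_summable : Summable s := by
    have h := (hasSum_weylSum_sq hN ht0 ht1).summable.mul_left (2 * π ^ 2)
    have hfun : s = fun i : ℕ => 2 * π ^ 2 *
        (‖weylSum t (i + 1)‖ ^ 2 / (2 * Real.pi ^ 2 * ((i : ℝ) + 1) ^ 2 * N ^ 2)) := by
      funext i
      simp only [hs]
      field_simp
    rw [hfun]
    exact h
  have hs0 : ∀ n, 0 ≤ s n := fun n => by rw [hs]; positivity
  have hLV : π ^ 2 * boxDiscrepancy t ^ 3 / 6 ≤ ∑' n, s n := by
    have h := leVeque hN ht0 ht1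
    have hs' : ∑' n, s n = ∑' n : ℕ, ‖weylSum t (n + 1)‖ ^ 2 / (((n : ℝ) + 1) ^ 2 * N ^ 2) := by
      rw [hs]
    rw [hs']
    have hπ : (0 : ℝ) < 6 / π ^ 2 := by positivity
    calc π ^ 2 * boxDiscrepancy t ^ 3 / 6 = boxDiscrepancy t ^ 3 / (6 / π ^ 2) := by
          field_simp
      _ ≤ _ := by
          rw [div_le_iff₀ hπ, mul_comm]
          convert h using 2
  have htail : ∑' n, s (n + H) ≤ 1 / H := by
    refine Real.tsum_le_of_sum_range_le (fun n => hs0 _) fun M => ?_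
    refine le_trans (Finset.sum_le_sum fun n _ => ?_) (sum_inv_sq_shift_le hH M)
    rw [hs]
    simp only
    have hSle : ‖weylSum t ((n + H : ℕ) + 1)‖ ^ 2 ≤ (N : ℝ) ^ 2 :=
      pow_le_pow_left₀ (norm_nonneg _) (norm_weylSum_le _ _) 2
    rw [div_le_div_iff₀ (by positivity) (by positivity)]
    push_cast at hSle ⊢
    have hsq : (0 : ℝ) ≤ ((n : ℝ) + H + 1) ^ 2 := sq_nonneg _
    nlinarith [mul_le_mul_of_nonneg_right hSle hsq]
  have hhead : π ^ 2 * boxDiscrepancy t ^ 3 / 6 - 1 / H ≤ ∑ n ∈ range H, s n := by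
    have := hs_summable.sum_add_tsum_nat_add H
    linarith
  have hcmp : r ^ H * (N : ℝ) ^ 2 * ∑ n ∈ range H, s n ≤ ∑ n ∈ range (H + 1), a n := by
    rw [Finset.sum_range_succ', Finset.mul_sum]
    have ha00 : a 0 = 0 := by rw [ha]; simp
    rw [ha00, add_zero]
    refine Finset.sum_le_sum fun n hn => ?_
    rw [Finset.mem_range] at hn
    rw [ha, hs]
    simp only
    have hn1 : (0 : ℝ) < (n : ℝ) + 1 := by positivity
    have hrpow : r ^ H ≤ r ^ (n + 1) := pow_le_pow_of_le_one hr0 hr1.le (by omega)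
    have hS0 : 0 ≤ ‖weylSum t (n + 1)‖ ^ 2 := by positivity
    push_cast
    rw [show r ^ H * (N : ℝ) ^ 2 * (‖weylSum t ((n : ℤ) + 1)‖ ^ 2 / (((n : ℝ) + 1) ^ 2 * (N : ℝ) ^ 2)) =
        r ^ H * ‖weylSum t ((n : ℤ) + 1)‖ ^ 2 / ((n : ℝ) + 1) ^ 2 by field_simp]
    rw [div_le_div_iff₀ (by positivity) hn1]
    have hS0' : 0 ≤ ‖weylSum t ((n : ℤ) + 1)‖ ^ 2 := by positivity
    calc r ^ H * ‖weylSum t ((n : ℤ) + 1)‖ ^ 2 * ((n : ℝ) + 1)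
        ≤ r ^ (n + 1) * ‖weylSum t ((n : ℤ) + 1)‖ ^ 2 * ((n : ℝ) + 1) := by gcongr
      _ ≤ r ^ (n + 1) * ‖weylSum t ((n : ℤ) + 1)‖ ^ 2 * ((n : ℝ) + 1) ^ 2 := by
          have : (n : ℝ) + 1 ≤ ((n : ℝ) + 1) ^ 2 := by nlinarith
          have h0 : 0 ≤ r ^ (n + 1) * ‖weylSum t ((n : ℤ) + 1)‖ ^ 2 := by positivity
          exact mul_le_mul_of_nonneg_left this h0
  -- Step 4: assemble
  have hLbound : L ≤ N * Real.log (1 / (1 - r)) -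
      r ^ H * (N : ℝ) ^ 2 * (π ^ 2 * boxDiscrepancy t ^ 3 / 6 - 1 / H) := by
    have hrH : 0 ≤ r ^ H * (N : ℝ) ^ 2 := by positivity
    have h1 : r ^ H * (N : ℝ) ^ 2 * (π ^ 2 * boxDiscrepancy t ^ 3 / 6 - 1 / H) ≤
        ∑ n ∈ range (H + 1), a n :=
      le_trans (mul_le_mul_of_nonneg_left hhead hrH) hcmp
    rw [one_div, Real.log_inv]
    linarith
  have h2r : (1 : ℝ) ≤ 2 / (1 + r) := by rw [le_div_iff₀ (by linarith)]; linarith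
  calc vandermondeAbs (fun n => unitPt (t n)) ^ 2
      ≤ (2 / (1 + r)) ^ (N * (N - 1)) * Real.exp L := hstep1
    _ ≤ (2 / (1 + r)) ^ (N * N) * Real.exp L :=
        mul_le_mul_of_nonneg_right (pow_le_pow_right₀ h2r (Nat.mul_le_mul_left N (Nat.sub_le N 1)))
          (Real.exp_nonneg _)
    _ = Real.exp ((N : ℝ) ^ 2 * Real.log (2 / (1 + r)) + L) := by
        rw [← Real.exp_log (pow_pos (by positivity : (0 : ℝ) < 2 / (1 + r)) (N * N)), Real.log_pow,
          ← Real.exp_add]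
        congr 1; push_cast; ring
    _ ≤ _ := by
        apply Real.exp_le_exp.mpr
        linarith

/-- Bilu's threshold `d₀(ε)`: with `κ = π²ε³/12`, `H = ⌈1/κ⌉`, `η = min(κ,1)/(8H)`, we take
`d₀(ε) = 8 log(1/η)/κ`. [cite: CalegariDimitrovTang2024, Lemma 64 (our explicit constants)] -/
def biluKappa (ε : ℝ) : ℝ := π ^ 2 * ε ^ 3 / 12

/-- The truncation parameter `H(ε) = ⌈1/κ(ε)⌉`.
[cite: CalegariDimitrovTang2024, Lemma 64 (our explicit constants)] -/
def biluH (ε : ℝ) : ℕ := ⌈1 / biluKappa ε⌉₊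

/-- `η(ε) = min(κ,1)/(8H)`, so that `r = 1 - η`.
[cite: CalegariDimitrovTang2024, Lemma 64 (our explicit constants)] -/
def biluEta (ε : ℝ) : ℝ := min (biluKappa ε) 1 / (8 * biluH ε)

/-- The threshold `d₀(ε) = 8 log(1/η(ε))/κ(ε)`.
[cite: CalegariDimitrovTang2024, Lemma 64 (our explicit constants)] -/
def biluThreshold (ε : ℝ) : ℝ := 8 * Real.log (1 / biluEta ε) / biluKappa ε

/-- `κ(ε) > 0`. [folklore] -/
theorem biluKappa_pos {ε : ℝ} (hε : 0 < ε) : 0 < biluKappa ε := by unfold biluKappa; positivity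

/-- `H(ε) ≥ 1`. [folklore] -/
theorem one_le_biluH {ε : ℝ} (hε : 0 < ε) : 1 ≤ biluH ε := by
  unfold biluH
  exact Nat.one_le_iff_ne_zero.mpr (Nat.ceil_pos.mpr (by have := biluKappa_pos hε; positivity)).ne'

/-- `1/H(ε) ≤ κ(ε)`. [folklore] -/
theorem one_div_biluH_le {ε : ℝ} (hε : 0 < ε) : 1 / (biluH ε : ℝ) ≤ biluKappa ε := by
  have hκ := biluKappa_pos hε
  have hH : (1 : ℝ) / biluKappa ε ≤ biluH ε := Nat.le_ceil _
  rw [div_le_iff₀ (by have := one_le_biluH hε; positivity)]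
  rw [div_le_iff₀ hκ] at hH
  linarith

/-- `η(ε) > 0`. [folklore] -/
theorem biluEta_pos {ε : ℝ} (hε : 0 < ε) : 0 < biluEta ε := by
  unfold biluEta
  have := biluKappa_pos hε
  have := one_le_biluH hε
  positivity

/-- `η ≤ κ/8` and `Hη ≤ 1/8`. [folklore] -/
theorem biluEta_le {ε : ℝ} (hε : 0 < ε) :
    biluEta ε ≤ biluKappa ε / 8 ∧ (biluH ε : ℝ) * biluEta ε ≤ 1 / 8 := by
  have hκ := biluKappa_pos hε
  have hH : (1 : ℝ) ≤ biluH ε := by exact_mod_cast one_le_biluH hε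
  unfold biluEta
  constructor
  · rw [div_le_div_iff₀ (by positivity) (by norm_num)]
    nlinarith [min_le_left (biluKappa ε) 1]
  · rw [mul_div_assoc', div_le_div_iff₀ (by positivity) (by norm_num)]
    nlinarith [min_le_right (biluKappa ε) 1]

/-- `η(ε) < 1`. [folklore] -/
theorem biluEta_lt_one {ε : ℝ} (hε : 0 < ε) : biluEta ε < 1 := by
  have h := (biluEta_le hε).2
  have hH : (1 : ℝ) ≤ biluH ε := by exact_mod_cast one_le_biluH hε
  have h0 := biluEta_pos hε
  nlinarith

/-- `d₀(ε) > 0`. [folklore] -/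
theorem biluThreshold_pos {ε : ℝ} (hε : 0 < ε) : 0 < biluThreshold ε := by
  unfold biluThreshold
  have hκ := biluKappa_pos hε
  have hlog : 0 < Real.log (1 / biluEta ε) :=
    Real.log_pos (by rw [lt_div_iff₀ (biluEta_pos hε)]; linarith [biluEta_lt_one hε])
  positivity

/-- **Bilu's non-equidistribution lemma, explicit form.** If `t ∈ [0,1)^N` has box discrepancy
`D(t) ≥ ε > 0` and `N ≥ d₀(ε)` (`biluThreshold`), then
`∏_{i<j} |e(t_i) - e(t_j)| < exp(-(π²ε³/192) N²)`.
[cite: CalegariDimitrovTang2024, Lemma 64; CalegariDimitrovTang2025, Lemma 13] -/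
theorem vandermondeAbs_lt_exp_of_le_boxDiscrepancy {ε : ℝ} (hε : 0 < ε) (hN : biluThreshold ε ≤ N)
    (t : Fin N → ℝ) (ht0 : ∀ n, 0 ≤ t n) (ht1 : ∀ n, t n < 1) (hD : ε ≤ boxDiscrepancy t) :
    vandermondeAbs (fun n => unitPt (t n)) < Real.exp (-(π ^ 2 * ε ^ 3 / 192) * (N : ℝ) ^ 2) := by
  -- constants
  set κ := biluKappa ε with hκdef
  set H := biluH ε with hHdef
  set η := biluEta ε with hηdef
  have hκ : 0 < κ := biluKappa_pos hε
  have hH1 : 1 ≤ H := one_le_biluH hε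
  have hHκ : 1 / (H : ℝ) ≤ κ := one_div_biluH_le hε
  have hη0 : 0 < η := biluEta_pos hε
  have hη1 : η < 1 := biluEta_lt_one hε
  have hηκ : η ≤ κ / 8 := (biluEta_le hε).1
  have hHη : (H : ℝ) * η ≤ 1 / 8 := (biluEta_le hε).2
  have hthr : 0 < biluThreshold ε := biluThreshold_pos hε
  have hNr : (0 : ℝ) < N := lt_of_lt_of_le hthr hN
  have hNpos : 0 < N := by exact_mod_cast hNr
  have hlogη : 0 < Real.log (1 / η) := Real.log_pos (by rw [lt_div_iff₀ hη0]; linarith)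
  have hNlog : (N : ℝ) * Real.log (1 / η) ≤ κ * (N : ℝ) ^ 2 / 8 := by
    have h1 : 8 * Real.log (1 / η) / κ ≤ N := hN
    rw [div_le_iff₀ hκ] at h1
    nlinarith
  -- the key estimate with `r = 1 - η`
  set r := 1 - η with hr
  have hr0 : 0 ≤ r := by linarith
  have hr1 : r < 1 := by linarith
  have hkey := vandermondeAbs_sq_le_exp t hNpos ht0 ht1 hr0 hr1 hH1
  -- `r^H ≥ 1/2` (Bernoulli)
  have hrH : 1 / 2 ≤ r ^ H := by
    have hb : 1 + (H : ℝ) * (-η) ≤ (1 + -η) ^ H := one_add_mul_le_pow (by linarith) H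
    rw [hr, sub_eq_add_neg]
    linarith
  -- `log(2/(1+r)) ≤ η`
  have hlog2 : Real.log (2 / (1 + r)) ≤ η := by
    have hpos : (0 : ℝ) < 2 / (1 + r) := by positivity
    calc Real.log (2 / (1 + r)) ≤ 2 / (1 + r) - 1 := Real.log_le_sub_one_of_pos hpos
      _ ≤ η := by
          rw [div_sub_one (by linarith), div_le_iff₀ (by linarith)]
          nlinarith
  -- `log(1/(1-r)) = log(1/η)`
  have hlog3 : Real.log (1 / (1 - r)) = Real.log (1 / η) := by rw [hr]; ring_nf
  -- discrepancy term
  have hD3 : π ^ 2 * ε ^ 3 / 6 - 1 / H ≤ π ^ 2 * boxDiscrepancy t ^ 3 / 6 - 1 / H := by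
    gcongr
  have hκ2 : κ ≤ π ^ 2 * ε ^ 3 / 6 - 1 / H := by
    have : π ^ 2 * ε ^ 3 / 6 = 2 * κ := by rw [hκdef, biluKappa]; ring
    linarith
  have hmain : (N : ℝ) ^ 2 * Real.log (2 / (1 + r)) + N * Real.log (1 / (1 - r))
      - r ^ H * (N : ℝ) ^ 2 * (π ^ 2 * boxDiscrepancy t ^ 3 / 6 - 1 / H) ≤ -(κ / 4) * (N : ℝ) ^ 2 := by
    have hN2 : (0 : ℝ) ≤ (N : ℝ) ^ 2 := by positivity
    have e1 : (N : ℝ) ^ 2 * Real.log (2 / (1 + r)) ≤ (N : ℝ) ^ 2 * (κ / 8) :=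
      mul_le_mul_of_nonneg_left (hlog2.trans hηκ) hN2
    have e3 : r ^ H * (N : ℝ) ^ 2 * (π ^ 2 * boxDiscrepancy t ^ 3 / 6 - 1 / H) ≥
        (1 / 2) * (N : ℝ) ^ 2 * κ := by
      have hk0 : 0 ≤ π ^ 2 * boxDiscrepancy t ^ 3 / 6 - 1 / H := by linarith
      calc r ^ H * (N : ℝ) ^ 2 * (π ^ 2 * boxDiscrepancy t ^ 3 / 6 - 1 / H)
          ≥ (1 / 2) * (N : ℝ) ^ 2 * (π ^ 2 * boxDiscrepancy t ^ 3 / 6 - 1 / H) := by gcongr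
        _ ≥ (1 / 2) * (N : ℝ) ^ 2 * κ := by gcongr; exact hκ2.trans hD3
    rw [hlog3]
    nlinarith
  have hsq : vandermondeAbs (fun n => unitPt (t n)) ^ 2 ≤ Real.exp (-(κ / 4) * (N : ℝ) ^ 2) :=
    hkey.trans (Real.exp_le_exp.mpr hmain)
  have hV : vandermondeAbs (fun n => unitPt (t n)) ≤ Real.exp (-(κ / 8) * (N : ℝ) ^ 2) := by
    have h0 := vandermondeAbs_nonneg (fun n => unitPt (t n))
    have : Real.exp (-(κ / 4) * (N : ℝ) ^ 2) = Real.exp (-(κ / 8) * (N : ℝ) ^ 2) ^ 2 := by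
      rw [← Real.exp_nat_mul]; ring_nf
    rw [this] at hsq
    exact (pow_le_pow_iff_left₀ h0 (Real.exp_nonneg _) two_ne_zero).mp hsq
  refine lt_of_le_of_lt hV (Real.exp_lt_exp.mpr ?_)
  have : π ^ 2 * ε ^ 3 / 192 = κ / 16 := by rw [hκdef, biluKappa]; ring
  rw [this]
  nlinarith [pow_pos hNr 2]

/-- **Bilu's non-equidistribution lemma** (CDT 2024 Lemma 64 / CDT 2021 Lemma 13, as printed):
there are functions `c(ε) > 0` and `d₀(ε)` such that for every `ε > 0`, if `d ≥ d₀(ε)` and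
`z = e(t) ∈ 𝕋ᵈ` has discrepancy `D(z) ≥ ε`, then `|V(z)| = ∏_{i<j} |z_i - z_j| < e^{-c(ε) d²}`.
[cite: CalegariDimitrovTang2024, §6.5.1 Lemma 64; CalegariDimitrovTang2025, §2.5.1 Lemma 13] -/
theorem bilu_nonEquidistribution :
    ∃ (c d₀ : ℝ → ℝ), ∀ ε : ℝ, 0 < ε → 0 < c ε ∧
      ∀ (d : ℕ), d₀ ε ≤ d → ∀ t : Fin d → ℝ, (∀ n, 0 ≤ t n) → (∀ n, t n < 1) →
        ε ≤ boxDiscrepancy t →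
          vandermondeAbs (fun n => unitPt (t n)) < Real.exp (-c ε * (d : ℝ) ^ 2) :=
  ⟨fun ε => π ^ 2 * ε ^ 3 / 192, biluThreshold, fun ε hε =>
    ⟨by positivity, fun d hd t ht0 ht1 hD => vandermondeAbs_lt_exp_of_le_boxDiscrepancy hε hd t ht0 ht1 hD⟩⟩

end

end Discrepancy

end Literature.NumberTheory.DiophantineApproximation
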